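import Summits.BirchSwinnertonDyer.Rank1Residual.Supersingular.KobayashiMainConjectureX6BSTWScope
import Summits.BirchSwinnertonDyer.Rank1Residual.Supersingular.X6VisibilityTamDefectShape
import Mathlib.Tactic.NormNum.LegendreSymbol
import HarnessLib

/-!
# Route `SignedLowerHalves`, crux `KobayashiLowerHalfSemistable` (item stmt-BirchSwinnertonDyer-19000): the fourth
# X6 rank-0 residue cell at `p ≥ 5`, `399190l1 @ 7`, is INSIDE the cell-verified scope of BSTW Thm 1.3 — a
# kernel-checked L-witness (cell `bsd-ssimc`, seat `bsd-ssimc-k3-c2` gen 0; companion of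
# `SignedLowerHalvesKobayashiLowerHalfSemistableScope.lean`; a `--supports … --as helper` file, closes nothing)

PARTITION (cell bsd-ssimc): X6 ∧ r = 0 residue × `399190l1 @ 7` (the last of the four N4 TAM-DEFECT cells
22678e1@5, 130798a1@7, 399190l1@7, 492414f1@5) — types-the-object-of; closes NONE. HONEST FRAMING: nothing here
proves Kobayashi's conjecture; `BurungaleSkinnerTianWan2024_thm13_scoped_OPEN` is the CELL-VERIFIED SCOPE of an
UNREFEREED preprint (REPORT-bstw-6 7a95ba616d84dc36 + NOTE-W-ref-2 (α)); the item stays OPEN; NOT a booking.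

`399190l1 = [1,−1,1,−8615202972,−2594053676135591]` (Cremona, lane ecdata allcurves), `N = 2·5·11·19·191`,
`Δ_min = −2·5·11·19²¹·191²`, `gcd(Δ, c₄) = 1` (`c₄ = 3·401·4027·85361`), `#Ẽ(𝔽₇) = 8` (`a₇ = 0`). Witness: the (ram)
prime `q = 11` (`ord₁₁ Δ = 1`) and `L = ℚ(√−31)`: `(−31/ℓ) = +1` for `ℓ ∈ {2, 5, 7, 19, 191}`, `(−31/11) = −1`,
`(31, 2N) = 1`, `h(−31) = 3`, `7 ∤ 3`. Independent engine check (PARI `qfbclassno`/`kronecker`, kit j248783) of the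
three companion witnesses agrees; this one found by the seat's script `scripts/s2_witness_search.py` (alternatives
`(D, q, h) = (167, 5, 11), (591, 191, 22), (887, 5, 29)`).

References: [BurungaleSkinnerTianWan2024] Thm 1.3, II §2.3 (PRE); [Kobayashi2003] Conjecture (p. 2); [Cox2013]
Thm 2.13 / 7.7(ii); [Cremona2006] Table 1.
-/

set_option autoImplicit false
set_option linter.dupNamespace false

noncomputable section

namespace Summit.BirchSwinnertonDyer.BirchSwinnertonDyer.Theorems

open scoped Classical

open WeierstrassCurve NumberField Literature.NumberTheory.EllipticCurves
  Literature.NumberTheory.EllipticCurves.Rank1Residual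
  Literature.NumberTheory.EllipticCurves.Rank1Residual.X11RankOneCertificates
  Summit.BirchSwinnertonDyer.Rank1Residual.Supersingular
  Summit.BirchSwinnertonDyer.Rank1Residual.X11b
  Summit.BirchSwinnertonDyer.BirchSwinnertonDyer.Rank1Residual.IntModel

/-- `#Ẽ(𝔽₇) = 8` for `399190l1` (`a₇ = 0`: good SUPERSINGULAR at `7`; kernel count). [folklore] -/
theorem card_c399190l1_7 :
    Nat.card (((⟨1, -1, 1, -8615202972, -2594053676135591⟩ : WeierstrassCurve ℤ).map
      (Int.castRingHom (ZMod 7))).toAffine.Point) = 8 :=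
  haveI : Fact (Nat.Prime 7) := ⟨by norm_num⟩
  natCard_point_eq_of_countPoints 1 (-1) 1 (-8615202972) (-2594053676135591) 7 (by norm_num) (by decide +kernel)
    (by decide +kernel)

/-- **L-witness for `399190l1` at `p = 7`: `q = 11`, `L = ℚ(√−31)` (`h = 3`).** Unconditional; per pair; closes nothing.
[cite: Cremona2006, Table 1 (Cremona label 399190l1)] [cite: Cox2013, Thm. 2.13 (h(−31) = 3 by reduced forms)] -/
theorem BSTWScope_hasWitness_c399190l1_7 {W : WeierstrassCurve ℚ} [W.IsElliptic] [W.IsGloballyMinimal]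
    (hWeq : W = ⟨1, -1, 1, -8615202972, -2594053676135591⟩) :
    haveI : Fact (Nat.Prime 7) := ⟨by norm_num⟩
    BSTWScope.HasWitness W 7 := by
  haveI : Fact (Nat.Prime 7) := ⟨by norm_num⟩
  haveI h11 : Fact (Nat.Prime 11) := ⟨by norm_num⟩
  have hIW : integralModelInt W = ⟨1, -1, 1, -8615202972, -2594053676135591⟩ :=
    integralModelInt_eq_of_map_eq _ (by rw [hWeq]; ext <;> simp [WeierstrassCurve.map])
  set Lp : List ℕ := [2, 5, 11, 19, 191] with hLp
  have hLprime : ∀ q ∈ Lp, q.Prime := by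
    simp only [hLp, List.mem_cons, List.mem_nil_iff, or_false]
    rintro q (rfl | rfl | rfl | rfl | rfl) <;> norm_num
  have hΔE : ∀ q : ℕ, q.Prime →
      (q : ℤ) ∣ (⟨1, -1, 1, -8615202972, -2594053676135591⟩ : WeierstrassCurve ℤ).Δ → q ∈ Lp :=
    forall_mem_of_natAbs_eq_prod_pow Lp [1, 1, 1, 21, 2] hLprime (by decide +kernel)
  have hbadmem : ∀ ℓ : ℕ, (hℓ : ℓ.Prime) →
      (haveI : Fact ℓ.Prime := ⟨hℓ⟩; ¬ W.HasGoodReductionAtPrime ℓ) → ℓ ∈ Lp := by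
    intro ℓ hℓ hbad
    haveI : Fact ℓ.Prime := ⟨hℓ⟩
    have hd := natCast_dvd_minimalDiscriminantInt_of_not_hasGoodReductionAtPrime (W := W) ℓ hbad
    rw [minimalDiscriminantInt_eq hIW] at hd
    exact hΔE ℓ hℓ hd
  have haux : BSTWScope.IsAuxiliaryPrime W 7 11 := by
    refine ⟨by decide, hasMultiplicativeReductionAtPrime_of_intModel hIW 11 (by decide +kernel)
      (by decide +kernel), ?_⟩
    rw [minimalDiscriminantInt_eq hIW,
      padicValInt_eq_of_dvd_of_not_dvd 11 (e := 1) (by decide +kernel) (by decide +kernel)]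
    decide
  refine BSTWScope.hasWitness_of_kronecker W 7 (by decide) 11 haux 31 ⟨by norm_num, ?_, by norm_num⟩
    (by norm_num) (by norm_num) ?_ ?_ (fun _ => by norm_num) ?_
  · exact Int.squarefree_natAbs.mp (by simpa using (by norm_num : Nat.Prime 31).squarefree)
  · intro ℓ hℓ hbad
    have hmem := hbadmem ℓ hℓ hbad
    simp only [hLp, List.mem_cons, List.mem_nil_iff, or_false] at hmem
    rcases hmem with rfl | rfl | rfl | rfl | rfl <;> decide
  · intro ℓ hℓ hℓq hbad
    have hmem := hbadmem ℓ hℓ hbad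
    simp only [hLp, List.mem_cons, List.mem_nil_iff, or_false] at hmem
    rcases hmem with rfl | rfl | rfl | rfl | rfl
    · exact ⟨fun _ => by norm_num, fun h => absurd rfl h⟩
    · exact ⟨fun h => absurd h (by decide), fun _ => by norm_num⟩
    · exact absurd rfl hℓq
    · exact ⟨fun h => absurd h (by decide), fun _ => by norm_num⟩
    · exact ⟨fun h => absurd h (by decide), fun _ => by norm_num⟩
  · have h3 : Literature.NumberTheory.QuadraticFields.BinaryQuadraticForm.classNumber (-(31 : ℕ) : ℤ) = 3 := by
      decide +kernel
    rw [h3]; decide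

/-- **The Eisenstein half for `399190l1` at `7`, both signs, MODULO ONLY the scoped binder** (class X6 read off the
model: `classX6_of_intModel` with `card_c399190l1_7`). CONDITIONAL; per pair; closes nothing.
[claim: BurungaleSkinnerTianWan2024, status: under-review] [cite: Cremona2006, Table 1 (Cremona label 399190l1)] -/
theorem kobayashiLowerDivisibility_c399190l1_7_of_thm13_scoped_OPEN
    (hBSTW : BurungaleSkinnerTianWan2024_thm13_scoped_OPEN)
    {W : WeierstrassCurve ℚ} [W.IsElliptic] [W.IsGloballyMinimal]
    (hWeq : W = ⟨1, -1, 1, -8615202972, -2594053676135591⟩) (ε : ℤˣ) :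
    haveI : Fact (Nat.Prime 7) := ⟨by norm_num⟩
    Summit.BirchSwinnertonDyer.Rank1Residual.Supersingular.KobayashiLowerDivisibility W 7 ε := by
  haveI : Fact (Nat.Prime 7) := ⟨by norm_num⟩
  have hIW : integralModelInt W = ⟨1, -1, 1, -8615202972, -2594053676135591⟩ :=
    integralModelInt_eq_of_map_eq _ (by rw [hWeq]; ext <;> simp [WeierstrassCurve.map])
  have hX : ClassX6 W 7 :=
    classX6_of_intModel 7 (by norm_num) hIW (by decide +kernel) card_c399190l1_7 (by decide) (by decide +kernel)
  exact X6.kobayashiLowerDivisibility_of_thm13_scoped_OPEN W 7 hBSTW (by norm_num) hX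
    (BSTWScope_hasWitness_c399190l1_7 hWeq) ε

end Summit.BirchSwinnertonDyer.BirchSwinnertonDyer.Theorems

end
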